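import Summits.KontsevichZagierPeriods.KontsevichZagierPeriods.Theorems.SoloInformedSegSpan
import HarnessLib
import HarnessLib.Audit

/-!
# SoloInformed — polar pieces of a rational integrand are segments

Solo programme `solo-KontsevichZagierPeriods-informed`, session s112 (kernel project
«`SoloInformedKZPUpTo 1` unconditionally from the tree's kernel Baker theorem»), file 8.

The Baker normal form of a rational function (`KZ.BakerSectorComplex.exists_bakerNormalForm`)
writes `P/Q = ρ' + Σ_k (γ_k(−p_k + (p_k² + q_k²)x) + δ_k q_k)/((1 − p_k x)² + (q_k x)²)`.  Here we
identify the polar term with `Re(G_k · (−ν_k)/(1 − ν_k x))` (`G_k = γ_k + iδ_k`,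
`ν_k = p_k + i q_k`; `soloInformed_polFun_apply_eq`) and show that its integral over a band
`[u, v]` on which `1 − ν_k x ≠ 0` is, modulo the Kontsevich–Zagier relations (one affine change
of variables), the SEGMENT `Seg(G_k, (1 − ν_k v)/(1 − ν_k u))` of file 3
(`soloInformed_segRep_sub_polRep_mem_relations`), whose end point ratio lies off `(−∞,0]`
because the segment `{1 − ν_k x | u ≤ x ≤ v}` misses `0`.

References: M. Kontsevich, D. Zagier, *Periods* (2001), §1.2; this work.
-/

noncomputable section

open scoped BigOperators ComplexConjugate
open MeasureTheory Set Filter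
open Literature.ModelTheory.ExponentialFields
open Literature.NumberTheory.Transcendental Literature.NumberTheory.Transcendental.KZ

namespace Summit.KontsevichZagierPeriods.KontsevichZagierPeriods.Theorems

/-! ### Bands over the point with algebraic end points -/

/-- The band `[u, v] ⊆ ℝ¹` over the point `ℝ⁰`. -/
def soloInformedBandUV (u v : ℝ) : Set (Fin 1 → ℝ) :=
  KZlog.band (univ : Set (Fin 0 → ℝ)) (fun _ => u) (fun _ => v)

/-- Membership in `[u, v]`. -/
theorem soloInformed_mem_bandUV {u v : ℝ} {y : Fin 1 → ℝ} :
    y ∈ soloInformedBandUV u v ↔ u ≤ y 0 ∧ y 0 ≤ v := by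
  simp only [soloInformedBandUV, KZlog.mem_band, mem_univ, true_and]
  rfl

/-- The unit band is `[0, 1]`. -/
theorem soloInformed_unitBand_eq_bandUV : soloInformedUnitBand = soloInformedBandUV 0 1 := rfl

/-- Constant edge functions with algebraic values over the point are semialgebraic. -/
theorem soloInformed_isSemialgebraicFunOn_const_base {u : ℝ} (hu : IsAlgebraic ℚ u) :
    IsSemialgebraicFunOn ℚ (univ : Set (Fin 0 → ℝ)) (fun _ => u) :=
  isSemialgebraicFunOn_const_of_isAlgebraic isSemialgebraic_univ hu

/-- `[u, v]` is `ℚ`-semialgebraic for algebraic end points. -/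
theorem soloInformed_isSemialgebraic_bandUV {u v : ℝ} (hu : IsAlgebraic ℚ u)
    (hv : IsAlgebraic ℚ v) : IsSemialgebraic ℚ (soloInformedBandUV u v) :=
  KZlog.isSemialgebraic_band (soloInformed_isSemialgebraicFunOn_const_base hu)
    (soloInformed_isSemialgebraicFunOn_const_base hv)

/-- `[u, v]` as an order interval of `ℝ¹`. -/
theorem soloInformed_bandUV_eq_Icc (u v : ℝ) :
    soloInformedBandUV u v = Icc (fun _ => u) (fun _ => v) := by
  ext y
  rw [soloInformed_mem_bandUV, mem_Icc, Pi.le_def, Pi.le_def, Fin.forall_fin_one,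
    Fin.forall_fin_one]

/-- `[u, v]` is compact. -/
theorem soloInformed_isCompact_bandUV (u v : ℝ) : IsCompact (soloInformedBandUV u v) := by
  rw [soloInformed_bandUV_eq_Icc]
  exact isCompact_Icc

/-- The coordinate is semialgebraic on `[u, v]`. -/
theorem soloInformed_isSemialgebraicFunOn_bandUV_coord {u v : ℝ} (hu : IsAlgebraic ℚ u)
    (hv : IsAlgebraic ℚ v) : IsSemialgebraicFunOn ℚ (soloInformedBandUV u v) (fun y => y 0) :=
  (isSemialgebraicFunOn_aeval (soloInformed_isSemialgebraic_bandUV hu hv)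
    (MvPolynomial.X 0)).congr fun y _ => by simp

/-- Real algebraic numbers are algebraic as complex numbers (pair form, for end points). -/
theorem soloInformed_isAlgebraic_ofReal_pair {u v : ℝ} (hu : IsAlgebraic ℚ u)
    (hv : IsAlgebraic ℚ v) : IsAlgebraic ℚ (u : ℂ) ∧ IsAlgebraic ℚ (v : ℂ) :=
  ⟨by simpa using hu.algebraMap (A := ℂ), by simpa using hv.algebraMap (A := ℂ)⟩

/-! ### The polar integrand -/

/-- The polar integrand `x ↦ Re(G · (−ν)/(1 − ν x))`. -/
def soloInformedPolFun (G ν : ℂ) (y : Fin 1 → ℝ) : ℝ :=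
  (G * (-ν / (1 - ν * ((y 0 : ℝ) : ℂ)))).re

/-- The polar integrand is semialgebraic on a band missing the pole, for algebraic data. -/
theorem soloInformed_isSemialgebraicFunOn_polFun {G ν : ℂ} (hG : IsAlgebraic ℚ G)
    (hν : IsAlgebraic ℚ ν) {u v : ℝ} (hu : IsAlgebraic ℚ u) (hv : IsAlgebraic ℚ v)
    (hne : ∀ y ∈ soloInformedBandUV u v, 1 - ν * ((y 0 : ℝ) : ℂ) ≠ 0) :
    IsSemialgebraicFunOn ℚ (soloInformedBandUV u v) (soloInformedPolFun G ν) := by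
  have hI := soloInformed_isSemialgebraic_bandUV hu hv
  have hG' := isAlgebraic_re_im hG
  have hν' := isAlgebraic_re_im hν
  have hnν := isAlgebraic_re_im hν.neg
  have h1 : IsSemialgebraicFunOn ℚ (soloInformedBandUV u v) (fun _ => (1 : ℂ).re) ∧
      IsSemialgebraicFunOn ℚ (soloInformedBandUV u v) (fun _ => (1 : ℂ).im) :=
    re_im_const hI (by simpa using isAlgebraic_one) (by simpa using isAlgebraic_zero)
  unfold soloInformedPolFun
  exact (re_im_mul (re_im_const hI hG'.1 hG'.2) (re_im_div (re_im_const hI hnν.1 hnν.2)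
    (re_im_sub h1 (re_im_mul (re_im_const hI hν'.1 hν'.2)
      (re_im_ofReal hI (soloInformed_isSemialgebraicFunOn_bandUV_coord hu hv)))) hne)).1

/-- The polar integrand is continuous on a band missing the pole. -/
theorem soloInformed_continuousOn_polFun (G : ℂ) {ν : ℂ} {u v : ℝ}
    (hne : ∀ y ∈ soloInformedBandUV u v, 1 - ν * ((y 0 : ℝ) : ℂ) ≠ 0) :
    ContinuousOn (soloInformedPolFun G ν) (soloInformedBandUV u v) := by
  have hden : Continuous fun y : Fin 1 → ℝ => 1 - ν * ((y 0 : ℝ) : ℂ) :=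
    continuous_const.sub (continuous_const.mul (Complex.continuous_ofReal.comp
      (continuous_apply 0)))
  unfold soloInformedPolFun
  exact Complex.continuous_re.comp_continuousOn
    (continuousOn_const.mul (continuousOn_const.div hden.continuousOn hne))

/-- `|1 − ν x|²` in coordinates. -/
theorem soloInformed_normSq_one_sub (p q t : ℝ) :
    Complex.normSq (1 - (p + q * Complex.I) * (t : ℂ)) = (1 - p * t) ^ 2 + (q * t) ^ 2 := by
  simp [Complex.normSq_apply]
  ring

/-- **The polar integrand in real coordinates**: for `G = γ + iδ`, `ν = p + iq`,
`Re(G(−ν)/(1 − νx)) = (γ(−p + (p² + q²)x) + δ q)/((1 − p x)² + (q x)²)` — the polar term of the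
Baker normal form. -/
theorem soloInformed_polFun_apply_eq (γ δ p q : ℝ) (y : Fin 1 → ℝ) :
    soloInformedPolFun (γ + δ * Complex.I) (p + q * Complex.I) y =
      (γ * (-p + (p ^ 2 + q ^ 2) * y 0) + δ * q) / ((1 - p * y 0) ^ 2 + (q * y 0) ^ 2) := by
  unfold soloInformedPolFun
  have hn := soloInformed_normSq_one_sub p q (y 0)
  rw [Complex.mul_re, Complex.div_re, Complex.div_im, hn]
  simp only [Complex.neg_re, Complex.neg_im, Complex.add_re, Complex.add_im, Complex.mul_re,
    Complex.mul_im, Complex.ofReal_re, Complex.ofReal_im, Complex.I_re, Complex.I_im,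
    Complex.sub_re, Complex.sub_im, Complex.one_re, Complex.one_im, mul_zero, mul_one,
    sub_zero, add_zero, zero_add, zero_sub]
  field_simp
  ring

/-! ### Transport of the polar piece to a segment -/

/-- The affine reparametrisation `x = u + (v − u)s` turns `(v − u)·(−ν)/(1 − νx)` into
`(c − 1)/(1 + (c − 1)s)` with `c = (1 − νv)/(1 − νu)`. -/
theorem soloInformed_polar_reparam {ν : ℂ} {u v s : ℝ} (hu : 1 - ν * (u : ℂ) ≠ 0)
    (ht : 1 - ν * ((u + (v - u) * s : ℝ) : ℂ) ≠ 0) :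
    ((1 - ν * (v : ℂ)) / (1 - ν * (u : ℂ)) - 1) /
        (1 + ((1 - ν * (v : ℂ)) / (1 - ν * (u : ℂ)) - 1) * (s : ℂ)) =
      ((v - u : ℝ) : ℂ) * (-ν / (1 - ν * ((u + (v - u) * s : ℝ) : ℂ))) := by
  have h3 : 1 + ((1 - ν * (v : ℂ)) / (1 - ν * (u : ℂ)) - 1) * (s : ℂ) =
      (1 - ν * ((u + (v - u) * s : ℝ) : ℂ)) / (1 - ν * (u : ℂ)) := by
    field_simp
    push_cast
    ring
  rw [h3]
  field_simp
  push_cast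
  ring

/-- The segment `{1 − νx | u ≤ x ≤ v}` missing `0` forces `(1 − νv)/(1 − νu) ∉ (−∞, 0]`. -/
theorem soloInformed_endRatio_mem_slitPlane {ν : ℂ} {u v : ℝ} (huv : u < v)
    (hne : ∀ t ∈ Icc u v, 1 - ν * (t : ℂ) ≠ 0) :
    (1 - ν * (v : ℂ)) / (1 - ν * (u : ℂ)) ∈ Complex.slitPlane := by
  set c := (1 - ν * (v : ℂ)) / (1 - ν * (u : ℂ)) with hc
  have hcu := hne u ⟨le_rfl, huv.le⟩
  rw [Complex.mem_slitPlane_iff]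
  by_contra h
  simp only [not_or, not_lt, not_not] at h
  obtain ⟨hre, him⟩ := h
  set l : ℝ := -c.re with hl
  have hl0 : 0 ≤ l := by rw [hl]; linarith
  have hcl : c = -(l : ℂ) := Complex.ext (by simp [hl]) (by simp [him])
  have h1 : 1 - ν * (v : ℂ) = c * (1 - ν * (u : ℂ)) := by rw [hc, div_mul_cancel₀ _ hcu]
  rw [hcl] at h1
  have hl1 : (1 : ℝ) + l ≠ 0 := by linarith
  have hl1' : (1 : ℂ) + (l : ℂ) ≠ 0 := by exact_mod_cast hl1
  have ht : u + (v - u) / (1 + l) ∈ Icc u v := by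
    refine ⟨le_add_of_nonneg_right (div_nonneg (sub_nonneg.2 huv.le) (by linarith)), ?_⟩
    rw [add_comm, ← le_sub_iff_add_le]
    exact div_le_self (sub_nonneg.2 huv.le) (by linarith)
  apply hne _ ht
  have hq : (1 : ℂ) - ν * ((u + (v - u) / (1 + l) : ℝ) : ℂ) =
      ((1 + (l : ℂ)) - ν * (u : ℂ) * (1 + (l : ℂ)) - ν * ((v : ℂ) - (u : ℂ))) / (1 + (l : ℂ)) := by
    push_cast
    field_simp
    ring
  rw [hq, div_eq_zero_iff]
  left
  linear_combination h1

/-- The end point ratio is algebraic for algebraic data. -/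
theorem soloInformed_endRatio_isAlgebraic {ν : ℂ} {u v : ℝ} (hν : IsAlgebraic ℚ ν)
    (hu : IsAlgebraic ℚ u) (hv : IsAlgebraic ℚ v) :
    IsAlgebraic ℚ ((1 - ν * (v : ℂ)) / (1 - ν * (u : ℂ))) := by
  have h := soloInformed_isAlgebraic_ofReal_pair hu hv
  rw [div_eq_mul_inv]
  exact (isAlgebraic_one.sub (hν.mul h.2)).mul (isAlgebraic_one.sub (hν.mul h.1)).inv

/-- **The polar piece over `[u, v]` is a segment.** If `1 − νx ≠ 0` on `[u, v]` (`u < v`, all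
data algebraic) and `R = [[u, v], Re(G(−ν)/(1 − νx))]`, then `(G, c)` with
`c = (1 − νv)/(1 − νu)` is admissible and `[Seg(G, c)] − [R]` is a relation (the affine change of
variables `x = u + (v − u)s`, rule 2). [Kontsevich–Zagier 2001, §1.2; this work] -/
theorem soloInformed_segRep_sub_polRep_mem_relations {G ν : ℂ} {u v : ℝ} (hG : IsAlgebraic ℚ G)
    (hν : IsAlgebraic ℚ ν) (hu : IsAlgebraic ℚ u) (hv : IsAlgebraic ℚ v) (huv : u < v)
    (hne : ∀ t ∈ Icc u v, 1 - ν * (t : ℂ) ≠ 0) (R : IntegralRep 1)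
    (hRd : R.domain = soloInformedBandUV u v)
    (hRi : ∀ y ∈ soloInformedBandUV u v, R.integrand y = soloInformedPolFun G ν y) :
    SoloInformedSegAdm G ((1 - ν * (v : ℂ)) / (1 - ν * (u : ℂ))) ∧
      of (soloInformedSegRep G ((1 - ν * (v : ℂ)) / (1 - ν * (u : ℂ)))) - of R ∈ relations := by
  set c := (1 - ν * (v : ℂ)) / (1 - ν * (u : ℂ)) with hc
  have hadm : SoloInformedSegAdm G c :=
    ⟨hG, soloInformed_endRatio_isAlgebraic hν hu hv, soloInformed_endRatio_mem_slitPlane huv hne⟩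
  refine ⟨hadm, ?_⟩
  have hcu := hne u ⟨le_rfl, huv.le⟩
  have hβ : 0 < v - u := sub_pos.2 huv
  refine of_sub_of_mem_relations_of_affine (m := 0) (G := (univ : Set (Fin 0 → ℝ))) isOpen_univ
    (α := fun _ => u) (β := fun _ => v - u) (a := fun _ => (0 : ℝ)) (b := fun _ => (1 : ℝ))
    (a' := fun _ => u) (b' := fun _ => v)
    (soloInformed_isSemialgebraicFunOn_const_base hu)
    (soloInformed_isSemialgebraicFunOn_const_base (hv.sub hu))
    (differentiableOn_const _) (differentiableOn_const _) (fun _ _ => hβ)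
    (soloInformedSegRep G c) R (soloInformed_segRep_domain G c) hRd
    (fun _ _ => by ring) (fun _ _ => by ring) fun z hz => ?_
  rw [soloInformed_segRep_domain, soloInformed_mem_unitBand] at hz
  have hs0 : ∀ a : ℝ, (Fin.snoc (Fin.init z) a : Fin 1 → ℝ) 0 = a := fun _ => rfl
  have hzl : z (Fin.last 0) = z 0 := rfl
  have hmem : (Fin.snoc (Fin.init z) (u + (v - u) * z (Fin.last 0)) : Fin 1 → ℝ) ∈
      soloInformedBandUV u v := by
    rw [soloInformed_mem_bandUV, hs0, hzl]
    constructor <;> nlinarith [hz.1, hz.2]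
  have ht : u + (v - u) * z 0 ∈ Icc u v := by
    constructor <;> nlinarith [hz.1, hz.2]
  rw [soloInformed_segRep_integrand hadm, hRi _ hmem]
  unfold soloInformedSegFun soloInformedPolFun
  rw [hs0, hzl, hc, soloInformed_polar_reparam hcu (hne _ ht), mul_left_comm, Complex.re_ofReal_mul,
    mul_comm]

end Summit.KontsevichZagierPeriods.KontsevichZagierPeriods.Theorems
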